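import Summits.ValiantsHypothesis.ValiantsHypothesis.Theorems.KPlusLogSqLawDefinitePivotRankLawRefuted

/-!
# Route «KPlusLogSqLaw», crux `WeakLifting` (stmt-ValiantsHypothesis-19561) — α register / Lift line:
# REALISING PRESCRIBED EIGENPAIRS BY A POSITIVE SEMIDEFINITE CONSTANT («exponential Sylvester» device)

HONEST FRAMING.  Helper file (`--supports stmt-ValiantsHypothesis-19561 --as helper`), seat val-sym-lift-p2 (g13), cell `pub-symmetroid`,
2026-08-28.  Pure linear algebra; it is the constructive device behind the counterexamples of `…DefinitePivotRankLawRefuted` (p608005,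
p609955), `…DefinitePivotEightZeros` (p611743) and `…DefinitePivotNineZeros` (p612213) and of memo RANK-LAW-REFUTED-liftp2g13.md §2:
to make prescribed times `t₁, …, t_m` eigen-times of a frame `det(D(t) − A)` with prescribed kernel vectors `x_k` (`D(t_k) x_k = A x_k`) and a
POSITIVE SEMIDEFINITE `A`, it suffices that the «cross» relations `x_kᵀ D(t_l) x_l = x_lᵀ D(t_k) x_k` hold (for diagonal/symmetric `D(t)` this is
`x_kᵀ (D(t_l) − D(t_k)) x_l = 0`) and that the matrix `G = [x_kᵀ D(t_l) x_l]` is positive definite: then `A := Y G⁻¹ Yᵀ` with `Y = [D(t₁)x₁ | ⋯ | D(t_m)x_m]`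
works.  (Necessity of both conditions for ANY PSD realisation is immediate: `G = XᵀAX`.)  Stated for arbitrary real square matrices `D k` in place of
`D(t_k)` — nothing about exponentials is used.  Nothing here bears on `WeakLifting`/`TropicalB` in their windows, Conjecture B, the Door-A registers,
`MatrixDescartes` (stmt-ValiantsHypothesis-18050) or VP ≠ VNP.

WHAT IS PROVED.  `realize_mulVec`: `(Y G⁻¹ Yᵀ) x_l = D_l x_l` for every `l`; `realize_posSemidef`: `Y G⁻¹ Yᵀ ⪰ 0`; packaged as
`exists_posSemidef_realizing`.  [folklore] (Gram matrices; `A = Y G⁻¹ Yᵀ`).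
-/

-- `Summit.ValiantsHypothesis.ValiantsHypothesis.…` repeats a component by the D-0017 layout
-- (single-conjunct summit), which the `dupNamespace` linter flags; the name is mandated.
set_option linter.dupNamespace false
set_option autoImplicit false

namespace Summit.ValiantsHypothesis.ValiantsHypothesis.Theorems.KPlusLogSqLaw.DefinitePivot

open Matrix
open scoped BigOperators

variable {n m : ℕ}

/-- **Realisation identity.**  With `Y i k = (D_k x_k) i` and `G k l = x_k ⬝ D_l x_l` positive definite and «cross-symmetric»
(`x_k ⬝ D_l x_l = x_l ⬝ D_k x_k`), the matrix `A = Y G⁻¹ Yᵀ` satisfies `A x_l = D_l x_l` for every `l`. [folklore] -/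
theorem realize_mulVec (D : Fin m → Matrix (Fin n) (Fin n) ℝ) (x : Fin m → Fin n → ℝ)
    (hR : ∀ k l, x k ⬝ᵥ (D l *ᵥ x l) = x l ⬝ᵥ (D k *ᵥ x k))
    (hG : (Matrix.of fun k l : Fin m => x k ⬝ᵥ (D l *ᵥ x l)).PosDef) (l : Fin m) :
    (Matrix.of (fun (i : Fin n) (k : Fin m) => (D k *ᵥ x k) i) *
          (Matrix.of fun k l : Fin m => x k ⬝ᵥ (D l *ᵥ x l))⁻¹ *
        (Matrix.of (fun (i : Fin n) (k : Fin m) => (D k *ᵥ x k) i))ᵀ) *ᵥ x l = D l *ᵥ x l := by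
  set Y : Matrix (Fin n) (Fin m) ℝ := Matrix.of (fun (i : Fin n) (k : Fin m) => (D k *ᵥ x k) i) with hY
  set G : Matrix (Fin m) (Fin m) ℝ := Matrix.of fun k l : Fin m => x k ⬝ᵥ (D l *ᵥ x l) with hGdef
  have hdet : IsUnit G.det := (Matrix.isUnit_iff_isUnit_det G).1 hG.isUnit
  -- `Yᵀ x_l` is the `l`-th column of `G`
  have hYt : Yᵀ *ᵥ x l = G *ᵥ Pi.single l 1 := by
    ext k
    have h1 : (Yᵀ *ᵥ x l) k = (D k *ᵥ x k) ⬝ᵥ x l := rfl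
    have h2 : (G *ᵥ Pi.single l (1 : ℝ)) k = G k l := by
      simp [Matrix.mulVec, dotProduct, Pi.single_apply]
    rw [h1, h2, dotProduct_comm, ← hR k l]
    rfl
  -- `Y e_l = D_l x_l`
  have hYe : Y *ᵥ Pi.single l (1 : ℝ) = D l *ᵥ x l := by
    ext i
    simp [Matrix.mulVec, dotProduct, Pi.single_apply, hY]
  calc (Y * G⁻¹ * Yᵀ) *ᵥ x l = Y *ᵥ (G⁻¹ *ᵥ (Yᵀ *ᵥ x l)) := by
        simp only [Matrix.mulVec_mulVec, Matrix.mul_assoc]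
    _ = Y *ᵥ (G⁻¹ *ᵥ (G *ᵥ Pi.single l 1)) := by rw [hYt]
    _ = Y *ᵥ Pi.single l 1 := by
        rw [Matrix.mulVec_mulVec (Pi.single l 1) G⁻¹ G, Matrix.nonsing_inv_mul _ hdet, Matrix.one_mulVec]
    _ = D l *ᵥ x l := hYe

/-- **The realisation is positive semidefinite**: `Y G⁻¹ Yᵀ ⪰ 0` whenever `G ≻ 0`. [folklore] -/
theorem realize_posSemidef (D : Fin m → Matrix (Fin n) (Fin n) ℝ) (x : Fin m → Fin n → ℝ)
    (hG : (Matrix.of fun k l : Fin m => x k ⬝ᵥ (D l *ᵥ x l)).PosDef) :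
    (Matrix.of (fun (i : Fin n) (k : Fin m) => (D k *ᵥ x k) i) *
          (Matrix.of fun k l : Fin m => x k ⬝ᵥ (D l *ᵥ x l))⁻¹ *
        (Matrix.of (fun (i : Fin n) (k : Fin m) => (D k *ᵥ x k) i))ᵀ).PosSemidef := by
  have h := hG.inv.posSemidef.mul_mul_conjTranspose_same
    (Matrix.of (fun (i : Fin n) (k : Fin m) => (D k *ᵥ x k) i))
  simpa only [Matrix.conjTranspose_eq_transpose_of_trivial] using h

/-- **Exponential-Sylvester realisation (packaged).**  Cross-symmetric eigen-data with a positive definite Gram-type matrix `G` are the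
eigenpairs of SOME positive semidefinite constant: `∃ A ⪰ 0, ∀ l, A x_l = D_l x_l`.  Applied with `D_k = diag(e^{νᵢ t_k})` (or `diag(r_k^{νᵢ})`)
this turns «`m` prescribed eigen-times with prescribed kernel vectors» into a finite system, the source of the rank-law counterexamples.
[folklore] -/
theorem exists_posSemidef_realizing (D : Fin m → Matrix (Fin n) (Fin n) ℝ) (x : Fin m → Fin n → ℝ)
    (hR : ∀ k l, x k ⬝ᵥ (D l *ᵥ x l) = x l ⬝ᵥ (D k *ᵥ x k))
    (hG : (Matrix.of fun k l : Fin m => x k ⬝ᵥ (D l *ᵥ x l)).PosDef) :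
    ∃ A : Matrix (Fin n) (Fin n) ℝ, A.PosSemidef ∧ ∀ l, A *ᵥ x l = D l *ᵥ x l :=
  ⟨_, realize_posSemidef D x hG, realize_mulVec D x hR hG⟩

end Summit.ValiantsHypothesis.ValiantsHypothesis.Theorems.KPlusLogSqLaw.DefinitePivot
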